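import Literature.MathematicalPhysics.QuantumFieldTheory.U1GinibreComparison
import HarnessLib

/-!
# Weak-coupling `U(1)₄`: existence of the free-boundary infinite-volume Wilson-loop expectations
(Ginibre), and the reduction of the Fröhlich–Spencer perimeter law to finite-volume bounds

Proof companion of `Literature/MathematicalPhysics/QuantumFieldTheory/U1WeakCouplingD4.lean`,
whose named fact `FrohlichSpencerU1PerimeterLawD4` (Fröhlich–Spencer 1982 / Guth 1980, as printed
for the Villain action in Garban–Sepúlveda 2023 Thm 1.2 with Prop. 2.11) is the conjunction, for
the Wilson-action `U(1)` theory on `ℤ⁴` at large `β` and every rectangular loop `γ`, of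

1. the existence of the limit `E_β[W_γ] = lim_n ⟨W_γ⟩_{Λ_n,β}` of the free-boundary expectations
   along the centred cubes `Λ_n = {-n,…,n}⁴` ("Existence of the limit is a standard consequence
   of Ginibre's inequalities (for the models with Wilson's and with Villain action)",
   Fröhlich–Spencer 1982 p. 419; Garban–Sepúlveda 2023 Prop. 2.11), and
2. the perimeter-law lower bound `E_β[W_γ] ≥ exp(-c(β)|γ|)` (Guth's theorem; the deconfining
   transition of four-dimensional compact lattice QED).

This file PROVES part 1 for every `β ≥ 0`, every base point, every coordinate plane and every
loop size (`hasBoxLimit_zdExpect_u1_wilsonLoop`), by the printed mechanism: by Ginibre's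
inequality (`Literature.Probability.LatticeModels.ginibreExpect_reChar_mono`, proved in the tree)
the cube expectation `⟨W_γ⟩_{Λ_n,β}` is non-decreasing in `n` as soon as `γ ⊆ Λ_n`
(`zdExpect_u1_wilsonLoop_box_mono`: enlarging the cube switches on further non-negative
plaquette couplings), and it is bounded by `1`; hence it converges, to its supremum. The
transfer of the free-boundary cube theory to a Ginibre model on a large discrete torus is the
one of `U1GinibreComparison.lean` (`zdExpect_u1_box_eq_ginibreExpect`, loops at the origin),
here re-run for loops at an arbitrary base point (`zdExpect_u1_box_eq_ginibreExpect_of_mem_box`).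

Part 2 is NOT proved here (it is the 44-page multiscale analysis of Fröhlich–Spencer 1982, resp.
Guth's 1980 duality/monopole-gas argument for the Villain action). What this file adds towards it
is the honest reduction `frohlichSpencerU1PerimeterLawD4_of_frequently_le_zdExpect`: granted
part 1, the fact follows from finite-volume perimeter bounds
`exp(-c(β)·2(R+T)) ≤ ⟨W_{R×T}⟩_{Λ_n,β}` holding for infinitely many (e.g. all large) cubes
`Λ_n` — which is the form in which the printed proofs establish it (bounds uniform in the
volume) — because the cube expectations increase to the limit.

## Sources

* J. Fröhlich, T. Spencer, Comm. Math. Phys. 83 (1982) 411–454, p. 416 footnote 2 and p. 419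
  (existence of the free-boundary limit from Ginibre's inequalities, Wilson and Villain actions).
  The body of the paper is not held by the tree's literature store (paywalled; acquisition
  requested); the quotations are those recorded in `U1VillainMasslessPhotonD4.lean`.
* C. Garban, A. Sepúlveda, IMRN 2023 (arXiv:2107.04021v2), Prop. 2.11 and its proof sketch
  ("This is stated both for the Wilson and Villain interaction in [FS82] as a standard consequence
  of Ginibre's inequalities").
* J. Ginibre, Comm. Math. Phys. 16 (1970) 310–328 (general Griffiths inequalities; the tree's
  `GinibreInequality.lean`).

## Design choices

* Everything is `d = 4`, `G = U(1) = Circle`, Wilson action, as in the parent file; the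
  monotonicity and the limit need `0 ≤ β` (ferromagnetic couplings), which is where Ginibre's
  inequality applies and which covers the large-`β` regime of the fact.
* The limit is packaged as `HasBoxLimit` (the parent fact's idiom) together with the two order
  facts actually used downstream: the cube expectations are eventually below the limit, and the
  limit is at most `1`.
* No new named fact is introduced (D-0026): the remaining input, Guth's finite-volume perimeter
  bound, appears only as the explicit hypothesis of the reduction theorem.
-/

noncomputable section

open MeasureTheory Filter Finset
open scoped Topology
open Literature.Probability.LatticeModels Literature.MathematicalPhysics.QuantumLattice

namespace Literature.MathematicalPhysics.QuantumFieldTheory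

open AreaLaw

/-! ### Geometry: a loop based in a small cube lies in every larger cube -/

section Geometry

variable {d : ℕ}

/-- A point `x + s eᵢ + t eⱼ` (`i ≠ j`, `0 ≤ s, t`) of a rectangle based at `x ∈ {-m,…,m}^d` lies
in the cube `{-n,…,n}^d` as soon as `s + m ≤ n` and `t + m ≤ n`. [folklore] -/
theorem add_single_add_single_mem_box {m n : ℕ} {x : Literature.Probability.LatticeModels.Site d}
    (hx : x ∈ box d m) {i j : Fin d} (hij : i ≠ j) {s t : ℤ} (hs0 : 0 ≤ s) (hs : s + m ≤ n)
    (ht0 : 0 ≤ t) (ht : t + m ≤ n) :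
    x + Pi.single i s + Pi.single j t ∈ box d n := by
  rw [mem_box] at hx ⊢
  intro k
  obtain ⟨hk1, hk2⟩ := hx k
  simp only [Pi.add_apply, Pi.single_apply]
  by_cases hki : k = i
  · have hkj : k ≠ j := fun hkj => hij (hki.symm.trans hkj)
    simp only [hki, if_true, if_neg (show i ≠ j from hij)]
    subst hki
    constructor <;> linarith
  · by_cases hkj : k = j
    · simp only [hkj, if_neg (Ne.symm hij), if_true]
      subst hkj
      constructor <;> linarith
    · simp only [if_neg hki, if_neg hkj]
      constructor <;> linarith

/-- The bonds of the `R × T` loop based at `x ∈ {-m,…,m}^d` in the `(i, j)` plane (`i ≠ j`) are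
based in the cube `{-n,…,n}^d` whenever `R + m ≤ n` and `T + m ≤ n` (the loop at the origin is
`TorusFreeTransfer`'s `fst_mem_box_of_mem_loopEdges`). [folklore] -/
theorem fst_mem_box_of_mem_loopEdges_of_mem_box {m n : ℕ}
    {x : Literature.Probability.LatticeModels.Site d} (hx : x ∈ box d m) {i j : Fin d} (hij : i ≠ j)
    {R T : ℕ} (hR : R + m ≤ n) (hT : T + m ≤ n) {e : ZdEdge d} (he : e ∈ loopEdges x i j R T) :
    e.1 ∈ box d n := by
  have hR' : (R : ℤ) + m ≤ n := by exact_mod_cast hR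
  have hT' : (T : ℤ) + m ≤ n := by exact_mod_cast hT
  simp only [loopEdges, Finset.mem_union] at he
  rcases he with ((he | he) | he) | he
  · obtain ⟨t, ht, rfl⟩ := mem_lineEdges_iff.1 he
    have : x + Pi.single i (t : ℤ) = x + Pi.single i (t : ℤ) + Pi.single j (0 : ℤ) := by simp
    rw [this]
    have ht' : (t : ℤ) ≤ R := by exact_mod_cast ht.le
    exact add_single_add_single_mem_box hx hij (by positivity) (by linarith) le_rfl (by linarith)
  · obtain ⟨t, ht, rfl⟩ := mem_lineEdges_iff.1 he
    have ht' : (t : ℤ) ≤ T := by exact_mod_cast ht.le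
    exact add_single_add_single_mem_box hx hij (by positivity) hR' (by positivity) (by linarith)
  · obtain ⟨t, ht, rfl⟩ := mem_lineEdges_iff.1 he
    have ht' : (t : ℤ) ≤ R := by exact_mod_cast ht.le
    rw [add_right_comm]
    exact add_single_add_single_mem_box hx hij (by positivity) (by linarith) (by positivity) hT'
  · obtain ⟨t, ht, rfl⟩ := mem_lineEdges_iff.1 he
    have : x + Pi.single j (t : ℤ) = x + Pi.single i (0 : ℤ) + Pi.single j (t : ℤ) := by simp
    rw [this]
    have ht' : (t : ℤ) ≤ T := by exact_mod_cast ht.le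
    exact add_single_add_single_mem_box hx hij le_rfl (by linarith) (by positivity) (by linarith)

end Geometry

/-! ### The free-boundary cube expectation of a loop at any base point as a torus Ginibre
expectation -/

section Transfer

/-- **The free-boundary cube Wilson-loop expectation of `U(1)₄` is a torus Ginibre expectation
with the switched-off couplings**, for a loop at an arbitrary base point `x ∈ {-m,…,m}⁴` with
`R + m ≤ n`, `T + m ≤ n` (so that the loop lies in `Λ_n`), `i ≠ j`, `2n ≤ L`: the proof of
`zdExpect_u1_box_eq_ginibreExpect` (loops at the origin) verbatim, the torus loop now sitting at
`Torus.proj (L+1) x`. [folklore] -/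
theorem zdExpect_u1_box_eq_ginibreExpect_of_mem_box {β : ℝ} {m n L : ℕ} (hnL : 2 * n ≤ L)
    {x : Literature.Probability.LatticeModels.Site 4} (hx : x ∈ box 4 m) {i j : Fin 4} (hij : i ≠ j)
    {R T : ℕ} (hR : R + m ≤ n) (hT : T + m ≤ n) :
    zdExpect u1Rep β (box 4 n) (zdWilsonLoop u1Rep x i j R T) =
      ginibreExpect (Measure.pi fun _ : Edge 4 (L + 1) => haarProbability Circle)
        (u1TorusChars L) (boxCoupling β n L)
        (reChar (u1RectChar (Torus.proj (L + 1) x) i j R T)) := by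
  classical
  -- support of the integrands and injectivity of the periodisation on it
  set S : Finset (ZdEdge 4) := (plaquettesIn (box 4 n)).biUnion Plaq.bonds ∪
    loopEdges x i j R T with hS
  have hSbox : ∀ e ∈ S, e.1 ∈ box 4 n := by
    intro e he
    rcases Finset.mem_union.1 he with he | he
    · obtain ⟨p, hp, hep⟩ := Finset.mem_biUnion.1 he
      exact Plaq.fst_mem_of_mem_bonds hp hep
    · exact fst_mem_box_of_mem_loopEdges_of_mem_box hx hij hR hT he
  have hinj : Set.InjOn (torusEdge (d := 4) (L + 1)) S := torusEdge_injOn hnL hSbox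
  have hsub1 : ∀ e, e ∈ (loopEdges x i j R T : Set (ZdEdge 4)) → e ∈ (S : Set (ZdEdge 4)) :=
    fun e he => Finset.mem_coe.2 (Finset.mem_union_right _ (Finset.mem_coe.1 he))
  have hsub2 : ∀ e, e ∈ (((plaquettesIn (box 4 n)).biUnion Plaq.bonds : Finset (ZdEdge 4)) :
      Set (ZdEdge 4)) → e ∈ (S : Set (ZdEdge 4)) := fun e he =>
    Finset.mem_coe.2 (Finset.mem_union_left _ (Finset.mem_coe.1 he))
  -- continuity and dependence
  have hWc := continuous_zdWilsonLoop u1Rep continuous_u1Rep x i j R T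
  have hwc : Continuous fun U : ZdGaugeConfig 4 Circle =>
      Real.exp (-β * zdWilsonAction u1Rep (box 4 n) U) :=
    Real.continuous_exp.comp
      (continuous_const.mul (continuous_zdWilsonAction u1Rep continuous_u1Rep _))
  have hdepw : DependsOn (fun U : ZdGaugeConfig 4 Circle =>
      Real.exp (-β * zdWilsonAction u1Rep (box 4 n) U)) (S : Set (ZdEdge 4)) := by
    intro U V h
    simp only
    rw [dependsOn_zdWilsonAction u1Rep (box 4 n) fun e he => h e (hsub2 e he)]
  have hdepWw : DependsOn (fun U : ZdGaugeConfig 4 Circle =>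
      zdWilsonLoop u1Rep x i j R T U *
        Real.exp (-β * zdWilsonAction u1Rep (box 4 n) U)) (S : Set (ZdEdge 4)) := by
    intro U V h
    simp only
    rw [dependsOn_zdWilsonLoop u1Rep _ i j R T fun e he => h e (hsub1 e he),
      dependsOn_zdWilsonAction u1Rep (box 4 n) fun e he => h e (hsub2 e he)]
  -- transfer to the torus
  have t1 : ∫ U, zdWilsonLoop u1Rep x i j R T U *
        Real.exp (-β * zdWilsonAction u1Rep (box 4 n) U) ∂zdHaar 4 Circle =
      ∫ U, zdWilsonLoop u1Rep x i j R T (torusLift (L + 1) U) *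
        Real.exp (-β * zdWilsonAction u1Rep (box 4 n) (torusLift (L + 1) U))
          ∂Measure.pi fun _ : Edge 4 (L + 1) => haarProbability Circle :=
    (integral_torusLift_eq_integral_zdHaar hinj (hWc.mul hwc).measurable hdepWw).symm
  have t2 : ∫ U, Real.exp (-β * zdWilsonAction u1Rep (box 4 n) U) ∂zdHaar 4 Circle =
      ∫ U, Real.exp (-β * zdWilsonAction u1Rep (box 4 n) (torusLift (L + 1) U))
          ∂Measure.pi fun _ : Edge 4 (L + 1) => haarProbability Circle :=
    (integral_torusLift_eq_integral_zdHaar hinj hwc.measurable hdepw).symm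
  rw [zdExpect_eq_div_integral u1Rep continuous_u1Rep, t1, t2, ginibreExpect]
  -- identify the periodised integrands
  have hw : ∀ U : GaugeConfig 4 (L + 1) Circle,
      Real.exp (-β * zdWilsonAction u1Rep (box 4 n) (torusLift (L + 1) U)) =
        Real.exp (-β * #(plaquettesIn (box 4 n))) *
          ginibreWeight (u1TorusChars L) (boxCoupling β n L) U := fun U => by
    rw [neg_mul_zdWilsonAction_box_torusLift hnL, Real.exp_add, ginibreWeight]
  simp_rw [hw, zdWilsonLoop_torusLift, wilsonLoop_u1Rep]
  set c := Real.exp (-β * #(plaquettesIn (box 4 n)))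
  have hc : c ≠ 0 := (Real.exp_pos _).ne'
  simp_rw [mul_left_comm _ c, integral_const_mul]
  rw [mul_div_mul_left _ _ hc]

end Transfer

/-! ### Ginibre monotonicity in the volume -/

section Monotone

/-- The switched-off couplings are monotone in the cube: enlarging `Λ_n` to `Λ_{n'}` switches on
(from `0` to `β ≥ 0`) the couplings of the new plaquettes and changes nothing else. [folklore] -/
theorem boxCoupling_mono {β : ℝ} (hβ : 0 ≤ β) {n n' : ℕ} (h : n ≤ n') (L : ℕ)
    (q : Plaquette 4 (L + 1)) : boxCoupling β n L q ≤ boxCoupling β n' L q := by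
  unfold boxCoupling
  by_cases hq : q ∈ (plaquettesIn (box 4 n)).image (plaqToTorus L)
  · have hq' : q ∈ (plaquettesIn (box 4 n')).image (plaqToTorus L) :=
      Finset.image_subset_image (Plaq.plaquettesIn_mono (box_mono 4 h)) hq
    rw [if_pos hq, if_pos hq']
  · rw [if_neg hq]
    split_ifs
    · exact hβ
    · exact le_rfl

/-- **Ginibre monotonicity in the volume (Fröhlich–Spencer 1982 p. 419; Garban–Sepúlveda 2023
Prop. 2.11, mechanism).** For Wilson-action `U(1)₄` at `β ≥ 0` and a rectangular loop contained in
the cube `Λ_n` (base point in `{-m,…,m}⁴`, `R + m ≤ n`, `T + m ≤ n`, `i ≠ j`), the free-boundary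
expectation `⟨W_γ⟩_{Λ_n,β}` is non-decreasing in `n`: both cubes are the same torus Ginibre model
with couplings `boxCoupling β n ≤ boxCoupling β n'`, and Ginibre's inequality is monotonicity in
the couplings. [folklore] -/
theorem zdExpect_u1_wilsonLoop_box_mono {β : ℝ} (hβ : 0 ≤ β) {m : ℕ}
    {x : Literature.Probability.LatticeModels.Site 4} (hx : x ∈ box 4 m) {i j : Fin 4} (hij : i ≠ j)
    {R T n n' : ℕ} (hR : R + m ≤ n) (hT : T + m ≤ n) (hnn' : n ≤ n') :
    zdExpect u1Rep β (box 4 n) (zdWilsonLoop u1Rep x i j R T) ≤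
      zdExpect u1Rep β (box 4 n') (zdWilsonLoop u1Rep x i j R T) := by
  have hnL : 2 * n ≤ 2 * n' := Nat.mul_le_mul_left 2 hnn'
  rw [zdExpect_u1_box_eq_ginibreExpect_of_mem_box hnL hx hij hR hT,
    zdExpect_u1_box_eq_ginibreExpect_of_mem_box le_rfl hx hij (hR.trans hnn') (hT.trans hnn')]
  exact ginibreExpect_reChar_mono _ (fun θ => exists_mul_self_eq_u1Config θ) _ _
    (fun q => boxCoupling_nonneg hβ n _ q) (fun q => boxCoupling_mono hβ hnn' _ q)

/-- `⟨W_γ⟩_{Λ,β} ≤ 1`: the Wilson loop of `U(1)` is a cosine and the free-boundary theory is a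
probability measure. [folklore] -/
theorem zdExpect_u1_wilsonLoop_le_one (β : ℝ)
    (Λ : Finset (Literature.Probability.LatticeModels.Site 4))
    (x : Literature.Probability.LatticeModels.Site 4) (i j : Fin 4) (R T : ℕ) :
    zdExpect u1Rep β Λ (zdWilsonLoop u1Rep x i j R T) ≤ 1 :=
  (abs_le.1 (abs_zdExpect_le continuous_u1Rep fun U =>
    abs_zdWilsonLoop_le u1Rep u1Rep_mem_unitaryGroup x i j R T U)).2

end Monotone

/-! ### Existence of the free-boundary infinite-volume Wilson-loop expectations -/

section Limit

/-- **Existence of the free-boundary infinite-volume Wilson-loop expectations of `U(1)₄`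
(Fröhlich–Spencer 1982 p. 419 / Garban–Sepúlveda 2023 Prop. 2.11, Wilson-loop case, Wilson
action).** For `β ≥ 0`, every base point `x`, every coordinate plane `(i, j)` with `i ≠ j` and
all `R, T`, the free-boundary cube expectations `⟨W_{R×T}(x)⟩_{Λ_n,β}` converge as `n → ∞`
("Existence of the limit is a standard consequence of Ginibre's inequalities (for the models with
Wilson's and with Villain action)"): they are eventually non-decreasing
(`zdExpect_u1_wilsonLoop_box_mono`) and bounded by `1`, so they increase to their supremum `w`;
in particular they are eventually `≤ w`, and `w ≤ 1`.
[cite: GarbanSepulveda2023, Prop. 2.11 (free-boundary infinite-volume limit via Ginibre; "stated both for the Wilson and Villain interaction in [FS82]"), Wilson-loop observables] -/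
theorem hasBoxLimit_zdExpect_u1_wilsonLoop {β : ℝ} (hβ : 0 ≤ β)
    (x : Literature.Probability.LatticeModels.Site 4) {i j : Fin 4} (hij : i ≠ j) (R T : ℕ) :
    ∃ w : ℝ, HasBoxLimit (fun Λ => zdExpect u1Rep β Λ (zdWilsonLoop u1Rep x i j R T)) w ∧
      (∀ᶠ n : ℕ in atTop, zdExpect u1Rep β (box 4 n) (zdWilsonLoop u1Rep x i j R T) ≤ w) ∧
        w ≤ 1 := by
  -- a cube containing the base point
  set m : ℕ := Site.supNorm x with hm
  have hx : x ∈ box 4 m := mem_box_iff_supNorm_le.2 le_rfl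
  -- the shifted sequence is monotone and bounded
  have hmono : Monotone fun k : ℕ =>
      zdExpect u1Rep β (box 4 (k + (R + T + m))) (zdWilsonLoop u1Rep x i j R T) := by
    intro k k' hkk'
    exact zdExpect_u1_wilsonLoop_box_mono hβ hx hij (by omega) (by omega) (by omega)
  have hbdd : BddAbove (Set.range fun k : ℕ =>
      zdExpect u1Rep β (box 4 (k + (R + T + m))) (zdWilsonLoop u1Rep x i j R T)) :=
    ⟨1, by rintro _ ⟨k, rfl⟩; exact zdExpect_u1_wilsonLoop_le_one β _ x i j R T⟩
  have hlim := tendsto_atTop_ciSup hmono hbdd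
  refine ⟨⨆ k : ℕ, zdExpect u1Rep β (box 4 (k + (R + T + m))) (zdWilsonLoop u1Rep x i j R T),
    ?_, ?_, ciSup_le fun k => zdExpect_u1_wilsonLoop_le_one β _ x i j R T⟩
  · change Tendsto (fun n : ℕ => zdExpect u1Rep β (box 4 n) (zdWilsonLoop u1Rep x i j R T))
      atTop _
    exact (tendsto_add_atTop_iff_nat (f := fun n : ℕ =>
      zdExpect u1Rep β (box 4 n) (zdWilsonLoop u1Rep x i j R T)) (R + T + m)).1 hlim
  · filter_upwards [eventually_ge_atTop (R + T + m)] with n hn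
    have h := le_ciSup hbdd (n - (R + T + m))
    simp only [Nat.sub_add_cancel hn] at h
    exact h

end Limit

/-! ### Reduction of the perimeter law to finite-volume bounds -/

section Reduction

/-- **Reduction of `FrohlichSpencerU1PerimeterLawD4` to finite-volume perimeter bounds.** If for
all large `β` there is `c(β) > 0` such that every rectangular loop obeys the free-boundary
finite-volume bound `exp(-c(β)·2(R+T)) ≤ ⟨W_{R×T}(x)⟩_{Λ_n,β}` for infinitely many cubes `Λ_n`
(in the printed proofs: for all cubes containing the loop, uniformly in the volume — Guth 1980,
Fröhlich–Spencer 1982), then the Fröhlich–Spencer perimeter law in its infinite-volume,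
free-boundary form holds: the limit exists by `hasBoxLimit_zdExpect_u1_wilsonLoop` (Ginibre) and
dominates the cube expectations eventually, so one cube where the bound holds suffices. The
threshold is raised to `max β₁ 0` to sit in the ferromagnetic regime. [folklore] -/
theorem frohlichSpencerU1PerimeterLawD4_of_frequently_le_zdExpect
    (h : ∃ β₁ : ℝ, ∀ β : ℝ, β₁ < β → ∃ c : ℝ, 0 < c ∧
      ∀ (x : Literature.Probability.LatticeModels.Site 4) (i j : Fin 4) (R T : ℕ),
        i ≠ j → 1 ≤ R → 1 ≤ T →
          ∃ᶠ n : ℕ in atTop, Real.exp (-c * (2 * (R + T))) ≤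
            zdExpect u1Rep β (box 4 n) (zdWilsonLoop u1Rep x i j R T)) :
    FrohlichSpencerU1PerimeterLawD4 := by
  obtain ⟨β₁, hβ₁⟩ := h
  refine ⟨max β₁ 0, fun β hβ => ?_⟩
  have hβ1 : β₁ < β := lt_of_le_of_lt (le_max_left _ _) hβ
  have hβ0 : 0 ≤ β := (lt_of_le_of_lt (le_max_right _ _) hβ).le
  obtain ⟨c, hc, hb⟩ := hβ₁ β hβ1
  refine ⟨c, hc, fun x i j R T hij hR hT => ?_⟩
  obtain ⟨w, hw, hev, -⟩ := hasBoxLimit_zdExpect_u1_wilsonLoop hβ0 x hij R T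
  obtain ⟨n, hn1, hn2⟩ := ((hb x i j R T hij hR hT).and_eventually hev).exists
  exact ⟨w, hw, hn1.trans hn2⟩

end Reduction

end Literature.MathematicalPhysics.QuantumFieldTheory
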